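import Summits.Ventures.PercRepro.RankDistMinor
import Summits.Ventures.PercRepro.RankDistTight

/-!
# PercRepro — the cumulative shadow inequality on the tight layer: a PARALLEL PAIR splits the shadow exactly
(p9, gen 19)

On the tight layer `|E| = p + q` (`RankDistTight`) every bottom set of `(p, q)` is an independent `q`-set with a
base as complement, so it contains EXACTLY ONE element of every parallel pair `{x, x'}` (`mem_Uq_parallel`).
This file holds the rank bookkeeping of the minor `M ／ x ＼ x'` (`parallelMinor_eRk_add_one`,
`eRk_eq_parallelMinor_add_one`: `ρ_M(A) = ρ_{M／x＼x'}(A ∖ {x, x'}) + 1` for every `A ⊆ E` meeting the pair) and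
the correspondence of the bottom sets (`insert_mem_Uq_iff_parallel`: `B₀ ∪ y ∈ 𝓑(M; p+1, q+1) ⟺
B₀ ∈ 𝓑(M ／ x ＼ x'; p, q)` for `y ∈ {x, x'}` and `B₀` avoiding the pair). `RankDistTightParallelCount` counts the
shadow levels (`s_{u+1}(M) = 3·s_u(M ／ x ＼ x')`) and draws the reduction of the cumulative shadow inequality.
A parallel pair is written out: `x ≠ x'`, both non-loops, `x' ∈ cl {x}`. Nothing here is a statement about any
window of the crux.
-/

namespace PercRepro.RankDist

open Set Finset _root_.Matroid PercRepro.ThmH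

variable {α : Type} [DecidableEq α] (M : Matroid α) [M.Finite]

section ParallelPair

variable {x x' : α}

omit [DecidableEq α] [M.Finite] in
/-- Adjoining `x'` to a set containing `x` keeps the rank (`x' ∈ cl {x}`). -/
lemma eRk_insert_parallel_right (hxx' : x' ∈ M.closure {x}) (A₀ : Set α) :
    M.eRk (insert x' (insert x A₀)) = M.eRk (insert x A₀) :=
  eRk_insert_eq_of_mem_closure M
    (M.closure_subset_closure (Set.singleton_subset_iff.2 (Set.mem_insert x A₀)) hxx')

omit [DecidableEq α] [M.Finite] in
/-- `x` and `x'` are interchangeable: `ρ(A₀ ∪ x') = ρ(A₀ ∪ x)`. -/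
lemma eRk_insert_parallel_left (hx' : M.IsNonloop x') (hxx' : x' ∈ M.closure {x}) (A₀ : Set α) :
    M.eRk (insert x' A₀) = M.eRk (insert x A₀) := by
  have hx : x ∈ M.closure {x'} := hx'.mem_closure_singleton hxx'
  have h1 : M.eRk (insert x (insert x' A₀)) = M.eRk (insert x' A₀) :=
    eRk_insert_eq_of_mem_closure M
      (M.closure_subset_closure (Set.singleton_subset_iff.2 (Set.mem_insert x' A₀)) hx)
  rw [← h1, Set.insert_comm, eRk_insert_parallel_right M hxx' A₀]

omit [DecidableEq α] [M.Finite] in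
/-- Removing `x'` from a set containing both `x` and `x'` keeps the rank. -/
lemma eRk_diff_parallel (hxx' : x' ∈ M.closure {x}) (hne : x ≠ x') {S : Set α} (hxS : x ∈ S)
    (hx'S : x' ∈ S) : M.eRk (S \ {x'}) = M.eRk S := by
  have h1 : insert x' (S \ {x'}) = S := by
    rw [Set.insert_sdiff_singleton, Set.insert_eq_of_mem hx'S]
  have h2 : x' ∈ M.closure (S \ {x'}) :=
    M.closure_subset_closure (Set.singleton_subset_iff.2
      (⟨hxS, fun h => hne (Set.mem_singleton_iff.1 h)⟩ : x ∈ S \ {x'})) hxx'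
  calc M.eRk (S \ {x'}) = M.eRk (insert x' (S \ {x'})) := (eRk_insert_eq_of_mem_closure M h2).symm
    _ = M.eRk S := by rw [h1]

omit [DecidableEq α] [M.Finite] in
/-- The ground set of the minor `M ／ x ＼ x'`. -/
lemma parallelMinor_ground : ((M.contract {x}).delete {x'}).E = M.E \ {x, x'} := by
  rw [delete_ground, contract_ground, Set.sdiff_sdiff, Set.singleton_union]

omit [DecidableEq α] [M.Finite] in
/-- The rank in the minor: `ρ_{M／x＼x'}(A₀) + 1 = ρ_M(A₀ ∪ x)` for `A₀ ⊆ E ∖ {x, x'}`. -/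
lemma parallelMinor_eRk_add_one (hx : M.IsNonloop x) {A₀ : Set α} (hA₀ : A₀ ⊆ M.E \ {x, x'}) :
    ((M.contract {x}).delete {x'}).eRk A₀ + 1 = M.eRk (insert x A₀) := by
  have h1 : A₀ ⊆ (M.contract {x}).E \ {x'} := by
    rw [contract_ground]
    intro a ha
    have := hA₀ ha
    simp only [Set.mem_sdiff, Set.mem_insert_iff, Set.mem_singleton_iff, not_or] at this ⊢
    exact ⟨⟨this.1, this.2.1⟩, this.2.2⟩
  have h2 : A₀ ⊆ M.E \ {x} := by
    intro a ha
    have := hA₀ ha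
    simp only [Set.mem_sdiff, Set.mem_insert_iff, Set.mem_singleton_iff, not_or] at this ⊢
    exact ⟨this.1, this.2.1⟩
  rw [deleteElem_eRk_eq (M.contract {x}) h1, contractElem_eRk_add_one M hx h2]

omit [DecidableEq α] [M.Finite] in
/-- The rank in the minor, with either element of the pair adjoined. -/
lemma parallelMinor_eRk_add_one' (hx : M.IsNonloop x) (hx' : M.IsNonloop x') (hxx' : x' ∈ M.closure {x})
    {y : α} (hy : y = x ∨ y = x') {A₀ : Set α} (hA₀ : A₀ ⊆ M.E \ {x, x'}) :
    ((M.contract {x}).delete {x'}).eRk A₀ + 1 = M.eRk (insert y A₀) := by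
  rcases hy with rfl | rfl
  · exact parallelMinor_eRk_add_one M hx hA₀
  · rw [eRk_insert_parallel_left M hx' hxx' A₀]
    exact parallelMinor_eRk_add_one M hx hA₀

/-- The ground finset of the minor. -/
lemma gr_parallelMinor : gr ((M.contract {x}).delete {x'}) = ((gr M).erase x).erase x' := by
  rw [gr_delete, gr_contract]

omit [DecidableEq α] in
/-- A subset of the minor's ground finset avoids `x` and `x'` and lies in `E`. -/
lemma coe_subset_of_subset_gr_parallelMinor {B₀ : Finset α}
    (hB₀ : B₀ ⊆ gr ((M.contract {x}).delete {x'})) : (B₀ : Set α) ⊆ M.E \ {x, x'} := by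
  rw [← parallelMinor_ground, ← coe_gr]
  exact_mod_cast hB₀

/-- On the tight layer `|E| = p + q`, a bottom set of `(p, q)` has exactly `q` elements and its complement
exactly `p` (no rank hypothesis on `M` needed). -/
lemma card_eq_of_mem_Uq_tight {p q : ℕ} (hn : (gr M).card = p + q) {B : Finset α}
    (hB : B ∈ PerFlat.Uq M p q) : B.card = q ∧ (gr M \ B).card = p := by
  rw [PerFlat.mem_Uq] at hB
  obtain ⟨hBE, hBq, hBp⟩ := hB
  have hsum : (gr M \ B).card + B.card = p + q := by rw [card_sdiff_add_card_eq_card hBE, hn]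
  have h1 : q ≤ B.card := by
    have := M.eRk_le_encard (B : Set α)
    rw [hBq, Set.encard_coe_eq_coe_finsetCard] at this
    exact_mod_cast this
  have h2 : p ≤ (gr M \ B).card := by
    have := M.eRk_le_encard ((gr M \ B : Finset α) : Set α)
    rw [hBp, Set.encard_coe_eq_coe_finsetCard] at this
    exact_mod_cast this
  omega

/-- **A bottom set of the tight layer contains exactly one element of a parallel pair.** -/
theorem mem_Uq_parallel {p q : ℕ} (hn : (gr M).card = p + q + 2) (hx : M.IsNonloop x) (hx' : M.IsNonloop x')
    (hxx' : x' ∈ M.closure {x}) (hne : x ≠ x') {B : Finset α} (hB : B ∈ PerFlat.Uq M (p + 1) (q + 1)) :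
    (x ∈ B ∧ x' ∉ B) ∨ (x ∉ B ∧ x' ∈ B) := by
  obtain ⟨hBq, hBp⟩ := card_eq_of_mem_Uq_tight M (p := p + 1) (q := q + 1) (by omega) hB
  rw [PerFlat.mem_Uq] at hB
  obtain ⟨hBE, hBrk, hDrk⟩ := hB
  have hxE : x ∈ gr M := by rw [← Finset.mem_coe, coe_gr]; exact hx.mem_ground
  have hx'E : x' ∈ gr M := by rw [← Finset.mem_coe, coe_gr]; exact hx'.mem_ground
  by_cases hxB : x ∈ B <;> by_cases hx'B : x' ∈ B
  · -- both in `B`: `B ∖ x'` has rank `q + 1` but `q` elements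
    exfalso
    have h1 : M.eRk ((B : Set α) \ {x'}) = ((q + 1 : ℕ) : ℕ∞) := by
      rw [eRk_diff_parallel M hxx' hne (Finset.mem_coe.2 hxB) (Finset.mem_coe.2 hx'B), hBrk]
    have h2 := M.eRk_le_encard ((B : Set α) \ {x'})
    rw [h1, ← Finset.coe_erase, Set.encard_coe_eq_coe_finsetCard, Finset.card_erase_of_mem hx'B, hBq] at h2
    have h3 : q + 1 ≤ q + 1 - 1 := by exact_mod_cast h2
    omega
  · exact Or.inl ⟨hxB, hx'B⟩
  · exact Or.inr ⟨hxB, hx'B⟩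
  · -- neither in `B`: both in the complement `D`, and `D ∖ x'` has rank `p + 1` but `p` elements
    exfalso
    have hxD : x ∈ gr M \ B := Finset.mem_sdiff.2 ⟨hxE, hxB⟩
    have hx'D : x' ∈ gr M \ B := Finset.mem_sdiff.2 ⟨hx'E, hx'B⟩
    have h1 : M.eRk (((gr M \ B : Finset α) : Set α) \ {x'}) = ((p + 1 : ℕ) : ℕ∞) := by
      rw [eRk_diff_parallel M hxx' hne (Finset.mem_coe.2 hxD) (Finset.mem_coe.2 hx'D), hDrk]
    have h2 := M.eRk_le_encard (((gr M \ B : Finset α) : Set α) \ {x'})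
    rw [h1, ← Finset.coe_erase, Set.encard_coe_eq_coe_finsetCard, Finset.card_erase_of_mem hx'D, hBp] at h2
    have h3 : p + 1 ≤ p + 1 - 1 := by exact_mod_cast h2
    omega

omit [M.Finite] in
/-- A subset of `E` meeting the pair has rank `ρ_{M／x＼x'}(A ∖ {x, x'}) + 1`. -/
theorem eRk_eq_parallelMinor_add_one (hx : M.IsNonloop x) (hx' : M.IsNonloop x') (hxx' : x' ∈ M.closure {x})
    {A : Set α} (hAE : A ⊆ M.E) (hA : x ∈ A ∨ x' ∈ A) :
    M.eRk A = ((M.contract {x}).delete {x'}).eRk (A \ {x, x'}) + 1 := by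
  have hA₀ : A \ {x, x'} ⊆ M.E \ {x, x'} := Set.sdiff_subset_sdiff_left hAE
  have hsub : ∀ z ∈ A, z = x ∨ z = x' ∨ z ∈ A \ {x, x'} := by
    intro z hz
    by_cases h1 : z = x
    · exact Or.inl h1
    by_cases h2 : z = x'
    · exact Or.inr (Or.inl h2)
    exact Or.inr (Or.inr ⟨hz, fun h => by
      simp only [Set.mem_insert_iff, Set.mem_singleton_iff] at h; exact h.elim h1 h2⟩)
  rcases hA with hxA | hx'A
  · have h1 : insert x (A \ {x, x'}) ⊆ A :=
      Set.insert_subset hxA Set.sdiff_subset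
    have h2 : A ⊆ insert x' (insert x (A \ {x, x'})) := by
      intro z hz
      rcases hsub z hz with rfl | rfl | h
      · exact Set.mem_insert_of_mem _ (Set.mem_insert _ _)
      · exact Set.mem_insert _ _
      · exact Set.mem_insert_of_mem _ (Set.mem_insert_of_mem _ h)
    have h3 : M.eRk A = M.eRk (insert x (A \ {x, x'})) :=
      le_antisymm ((M.eRk_mono h2).trans (eRk_insert_parallel_right M hxx' _).le) (M.eRk_mono h1)
    rw [h3, parallelMinor_eRk_add_one M hx hA₀]
  · have h1 : insert x' (A \ {x, x'}) ⊆ A :=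
      Set.insert_subset hx'A Set.sdiff_subset
    have h2 : A ⊆ insert x (insert x' (A \ {x, x'})) := by
      intro z hz
      rcases hsub z hz with rfl | rfl | h
      · exact Set.mem_insert _ _
      · exact Set.mem_insert_of_mem _ (Set.mem_insert _ _)
      · exact Set.mem_insert_of_mem _ (Set.mem_insert_of_mem _ h)
    have h4 : M.eRk (insert x (insert x' (A \ {x, x'}))) = M.eRk (insert x' (A \ {x, x'})) := by
      rw [Set.insert_comm, eRk_insert_parallel_right M hxx', eRk_insert_parallel_left M hx' hxx']
    have h3 : M.eRk A = M.eRk (insert x' (A \ {x, x'})) :=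
      le_antisymm ((M.eRk_mono h2).trans h4.le) (M.eRk_mono h1)
    rw [h3, parallelMinor_eRk_add_one' M hx hx' hxx' (Or.inr rfl) hA₀]

/-- The complement of `insert y B₀` in `E` is the complement of `B₀` in the minor's ground set plus the other
element `y'` of the pair. -/
lemma coe_sdiff_insert_parallel (hx : M.IsNonloop x) (hx' : M.IsNonloop x') (hne : x ≠ x') {y y' : α}
    (hyy' : (y = x ∧ y' = x') ∨ (y = x' ∧ y' = x)) {B₀ : Finset α}
    (hB₀ : B₀ ⊆ gr ((M.contract {x}).delete {x'})) :
    ((gr M \ insert y B₀ : Finset α) : Set α) =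
      insert y' ((gr ((M.contract {x}).delete {x'}) \ B₀ : Finset α) : Set α) := by
  have hB₀' := coe_subset_of_subset_gr_parallelMinor M hB₀
  have hxB : x ∉ B₀ := fun h => (hB₀' (Finset.mem_coe.2 h)).2 (Set.mem_insert _ _)
  have hx'B : x' ∉ B₀ := fun h => (hB₀' (Finset.mem_coe.2 h)).2 (Set.mem_insert_of_mem _ rfl)
  have hxE : x ∈ M.E := hx.mem_ground
  have hx'E : x' ∈ M.E := hx'.mem_ground
  rw [Finset.coe_sdiff, Finset.coe_sdiff, coe_gr, coe_gr, parallelMinor_ground, Finset.coe_insert]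
  ext z
  simp only [Set.mem_sdiff, Set.mem_insert_iff, Set.mem_singleton_iff, Finset.mem_coe, not_or]
  rcases hyy' with ⟨hy1, hy2⟩ | ⟨hy1, hy2⟩ <;> rw [hy1, hy2]
  · constructor
    · rintro ⟨hzE, hzy, hzB⟩
      by_cases hz : z = x'
      · exact Or.inl hz
      · exact Or.inr ⟨⟨hzE, hzy, hz⟩, hzB⟩
    · rintro (hz | ⟨⟨hzE, hz1, hz2⟩, hzB⟩)
      · rw [hz]; exact ⟨hx'E, fun h => hne h.symm, hx'B⟩
      · exact ⟨hzE, hz1, hzB⟩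
  · constructor
    · rintro ⟨hzE, hzy, hzB⟩
      by_cases hz : z = x
      · exact Or.inl hz
      · exact Or.inr ⟨⟨hzE, hz, hzy⟩, hzB⟩
    · rintro (hz | ⟨⟨hzE, hz1, hz2⟩, hzB⟩)
      · rw [hz]; exact ⟨hxE, hne, hxB⟩
      · exact ⟨hzE, hz2, hzB⟩

/-- **Bottom sets of the minor ↔ bottom sets of `M` through `y ∈ {x, x'}`** (`B₀` avoids the pair). -/
theorem insert_mem_Uq_iff_parallel {p q : ℕ} (hx : M.IsNonloop x) (hx' : M.IsNonloop x')
    (hxx' : x' ∈ M.closure {x}) (hne : x ≠ x') {y y' : α} (hyy' : (y = x ∧ y' = x') ∨ (y = x' ∧ y' = x))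
    {B₀ : Finset α} (hB₀ : B₀ ⊆ gr ((M.contract {x}).delete {x'})) :
    insert y B₀ ∈ PerFlat.Uq M (p + 1) (q + 1) ↔ B₀ ∈ PerFlat.Uq ((M.contract {x}).delete {x'}) p q := by
  have hB₀' := coe_subset_of_subset_gr_parallelMinor M hB₀
  have hy : y = x ∨ y = x' := by rcases hyy' with ⟨h, -⟩ | ⟨h, -⟩ <;> [exact Or.inl h; exact Or.inr h]
  have hy' : y' = x ∨ y' = x' := by rcases hyy' with ⟨-, h⟩ | ⟨-, h⟩ <;> [exact Or.inr h; exact Or.inl h]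
  have hyE : y ∈ gr M := by
    rw [← Finset.mem_coe, coe_gr]; rcases hy with rfl | rfl <;> [exact hx.mem_ground; exact hx'.mem_ground]
  have hB₀E : B₀ ⊆ gr M := by
    intro z hz; rw [← Finset.mem_coe, coe_gr]; exact (hB₀' (Finset.mem_coe.2 hz)).1
  have hD : ((gr ((M.contract {x}).delete {x'}) \ B₀ : Finset α) : Set α) ⊆ M.E \ {x, x'} := by
    rw [Finset.coe_sdiff, coe_gr, parallelMinor_ground]; exact Set.sdiff_subset
  rw [PerFlat.mem_Uq, PerFlat.mem_Uq, Finset.coe_insert,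
    coe_sdiff_insert_parallel M hx hx' hne hyy' hB₀,
    ← parallelMinor_eRk_add_one' M hx hx' hxx' hy hB₀',
    ← parallelMinor_eRk_add_one' M hx hx' hxx' hy' hD]
  constructor
  · rintro ⟨-, h1, h2⟩
    refine ⟨hB₀, ?_, ?_⟩
    · have h1' : ((M.contract {x}).delete {x'}).eRk (B₀ : Set α) + 1 = (q : ℕ∞) + 1 := by
        rw [h1]; push_cast; rfl
      exact WithTop.add_right_cancel (WithTop.one_ne_top) h1'
    · have h2' : ((M.contract {x}).delete {x'}).eRk
          ((gr ((M.contract {x}).delete {x'}) \ B₀ : Finset α) : Set α) + 1 = (p : ℕ∞) + 1 := by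
        rw [h2]; push_cast; rfl
      exact WithTop.add_right_cancel (WithTop.one_ne_top) h2'
  · rintro ⟨-, h1, h2⟩
    refine ⟨Finset.insert_subset hyE hB₀E, ?_, ?_⟩
    · rw [h1]; push_cast; rfl
    · rw [h2]; push_cast; rfl

end ParallelPair

end PercRepro.RankDist
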